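import Literature.IUT.HodgeTheaters.GlobalRealifiedFrobenioids
import Literature.IUT.HodgeArakelov.RealifiedMonoidRigidity
import HarnessLib

/-!
# [IUTchI] Example 3.5 (i)/(iii): the data `(C^⊩_mod, Prime(C^⊩_mod) ⥲ V_mod, {F^⊢_v̲}, {ρ_v})` is RIGID at the
# divisor-monoid level — local degrees are nonzero, every `ρ_v` is injective, automorphisms are trivial

Proof-only companion (abc-iut cell, D-0067 wave 4, seat abc-iut-w4-d009; 0 definitions, no typer file edited) of
`GlobalRealifiedFrobenioids.lean` (abc-iut-L5-t2, p405521: the divisor monoid `Φ_{C^⊩_mod} = V_mod →₀ ℝ≥0` of the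
global realified Frobenioid of [IUTchI] Ex. 3.5 (i) over REAL initial Θ-data, the distinguished elements
`log^⊢_mod(p_v)` (`logMod`), the prime components `Φ_{C^⊩_mod,v}` (`PhiModAt`), the local degrees
`[K_v̲ : (F_mod)_v]` (`Val.localDegree`, `localDegreeMod`) and the comparison isomorphisms
`ρ_v : Φ_{C^⊩_mod,v} ⥲ Φ^rlf_{C^⊢_v̲}`, "`log^⊢_mod(p_v) ↦ [K_v̲:(F_mod)_v]⁻¹ log_Φ(p_v)`" (`rho`, scalar `rhoScalar`),
and their `D`-versions of Ex. 3.5 (iii) (`rhoDScalar = rhoScalar`)).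

S. Mochizuki, *Inter-universal Teichmüller theory I*, kurims manuscript (May 2020), Example 3.5 (i) p. 84
("`ρ_v : Φ_{C^⊩_mod,v} ⥲ Φ^rlf_{C^⊢_v̲}` … [an isomorphism of topological monoids]"), (iii) p. 86 (the `D`-version
`F^⊩_D = (D^⊩_mod, Prime(D^⊩_mod) ⥲ V̲, {D^⊢_v̲}, {ρ^D_v̲})`); *II* (Dec 2020) Cor. 4.5 (ii) p. 132, Cor. 4.10 (v) p. 160
("the full poly-isomorphism `†D^⊢_△ ⥲ ‡D^⊢_△` induces AN isomorphism of collections of data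
`(D^⊩(†D^⊢_△), Prime(D^⊩(†D^⊢_△)) ⥲ V̲, {†ρ_{D^⊩,v}}_v) ⥲ (D^⊩(‡D^⊢_△), …)`"); *III* (May 2020) Thm. 1.5 (v) pp. 50–51.
Claim key `Mochizuki2012` DISPUTED (D-0012).

WHAT IS PROVED (classical algebraic number theory + bookkeeping, over L5-t2's REAL definitions):

* `Val.localDegree_pos` / `Val.localDegree_ne_zero` — the local degree `[B_w : A_u]` of a finite extension of
  number fields at any place is positive: at a finite place `e(w|u)·f(w|u) > 0` (Mathlib
  `Ideal.ramificationIdx_pos`, `Ideal.inertiaDeg_pos` for the prime `𝔭_w` of `𝓞 B` over `𝓞 A`,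
  `Module.Finite (𝓞 A) (𝓞 B)`), at an infinite place `mult(w)/mult(w|_A) ≥ 1` (`InfinitePlace.mult_comap_le`,
  `mult_pos`);
* `InitialThetaData.localDegreeMod_ne_zero`, `rhoScalar_ne_zero`, `rho_injective` — hence
  `[K_v̲ : (F_mod)_v] ≠ 0`, the printed scalar `[K_v̲:(F_mod)_v]⁻¹` of `ρ_v` is nonzero and `ρ_v` is INJECTIVE (the
  "⥲" of Ex. 3.5 (i) at the level typed: `rho w` is an injective `ℝ≥0`-linear map `ℝ≥0 → ℝ≥0`, indeed bijective —
  `rho_bijective`); the same for `ρ^D_v` (`rhoDScalar_ne_zero`);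
* **RIGIDITY** ([IUTchII] Cor. 4.5 (ii)/4.10 (v) "induces AN isomorphism", [IUTchIII] Thm. 1.5 (v), at the REAL
  divisor-monoid data of Ex. 3.5): an additive automorphism (indeed endomorphism) `e` of `Φ_{C^⊩_mod}` that
  (a) respects `Prime(C^⊩_mod) ⥲ V_mod` — acts prime-by-prime, `e(x·[v]) = e_v(x)·[v]` — and (b) is compatible with
  the comparison isomorphisms — at every `v ∈ V_mod` some `ρ_w` (`w ∈ V(K)` over `v`, e.g. `w = v̲ ∈ V̲`) satisfies
  `ρ_w ∘ e_v = ρ_w` (the local `D^⊢_v̲`-side realified monoid `(ℝ^⊢_{≥0})_v̲` being rigidified by its CANONICAL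
  Frobenius element, so that the local constituent of an induced isomorphism of data is the identity) — IS THE
  IDENTITY: `InitialThetaData.phiMod_addMonoidHom_eq_id_of_rho_compat`, `…_addEquiv_eq_refl_of_rho_compat`;
  variant with (b′) "`e` fixes the distinguished elements `log^⊢_mod(p_v)`": `…_eq_refl_of_fixes_logMod`.

This is the model-level input named in plan/GAP-LEDGER.md row G-w4d009-1 for the L6 consumer
`Literature.IUT.LogThetaLattice.BiCoricData.RealifiedRigidAt` / `Thm15vSingleIso` (companion
`BiCoresRealifiedRigidity.lean`, criterion `thm15vSingleIso_of_faithful_coordinates`): once the interface functor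
`BiCoricData.realified` is instantiated by these coordinates, "D^⊩(−) kills automorphisms" is the theorem below.
HONEST FRAMING: nothing here asserts a disputed claim or takes a side on [IUTchIII] Cor. 3.12; typed ≠ proved for
every interface-level statement upstream; the mathematics here is undisputed (local degrees, `ℝ≥0`-linear algebra).
-/

namespace Literature.IUT.HodgeTheaters

open NumberField IsDedekindDomain
open scoped NNReal

universe u v w

/-! ### Local degrees are positive -/

section LocalDegree

variable (A : Type u) {B : Type v} [Field A] [NumberField A] [Field B] [NumberField B] [Algebra A B]

/-- **IUTchI:Ex3.5(i)** (kurims p. 84, "`[K_v̲ : (F_mod)_v]`"): the local degree of a finite extension of number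
fields `A ⊆ B` at a place `w` of `B` is POSITIVE — `e(w|u)·f(w|u) ≥ 1` at a finite place, `mult(w)/mult(u) ≥ 1` at
an infinite one (classical). [claim: Mochizuki2012, status: disputed] -/
theorem Val.localDegree_pos (w : Val B) : 0 < Val.localDegree A w := by
  rcases w with w | w
  · -- infinite place: `mult (w|_A) ≤ mult w` and `0 < mult (w|_A)`
    change 0 < w.mult / (w.comap (algebraMap A B)).mult
    exact Nat.div_pos (InfinitePlace.mult_comap_le _ _) InfinitePlace.mult_pos
  · -- finite place: ramification index and inertia degree of `𝔭_w` over `𝓞 A` are positive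
    change 0 < (FinitePlace.maximalIdeal w).asIdeal.ramificationIdx (𝓞 A) *
      (FinitePlace.maximalIdeal w).asIdeal.inertiaDeg (𝓞 A)
    haveI := (FinitePlace.maximalIdeal w).isPrime
    exact Nat.mul_pos (Ideal.ramificationIdx_pos _ _) (Ideal.inertiaDeg_pos _ _)

/-- **IUTchI:Ex3.5(i)** (kurims p. 84): the local degree is nonzero. [claim: Mochizuki2012, status: disputed] -/
theorem Val.localDegree_ne_zero (w : Val B) : Val.localDegree A w ≠ 0 :=
  (Val.localDegree_pos A w).ne'

end LocalDegree

/-! ### `[K_v̲ : (F_mod)_v] ≠ 0`; `ρ_v`, `ρ^D_v` are injective -/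

section Ex35

variable {F : Type u} {K : Type v} {Fbar : Type w} [Field F] [NumberField F] [Field K]
  [NumberField K] [Algebra F K] [Field Fbar] [Algebra F Fbar] [Algebra K Fbar]
  {E : WeierstrassCurve F} [E.IsElliptic] {l : ℕ} {P : BadPlacePredicates K} (D : InitialThetaData F K Fbar E l P)

namespace InitialThetaData

/-- **IUTchI:Ex3.5(i)** (kurims p. 84): `[K_v̲ : (F_mod)_v] ≠ 0` (computed along `F_mod ⊆ F ⊆ K`).
[claim: Mochizuki2012, status: disputed] -/
theorem localDegreeMod_ne_zero (w : Val K) : D.localDegreeMod w ≠ 0 :=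
  mul_ne_zero (Val.localDegree_ne_zero F w) (Val.localDegree_ne_zero (fieldOfModuli E) _)

/-- **IUTchI:Ex3.5(i)** (kurims p. 84): `0 < [K_v̲ : (F_mod)_v]`. [claim: Mochizuki2012, status: disputed] -/
theorem localDegreeMod_pos (w : Val K) : 0 < D.localDegreeMod w :=
  Nat.pos_of_ne_zero (D.localDegreeMod_ne_zero w)

/-- **IUTchI:Ex3.5(i)** (kurims p. 84): the printed scalar `[K_v̲:(F_mod)_v]⁻¹` of `ρ_v` is nonzero.
[claim: Mochizuki2012, status: disputed] -/
theorem rhoScalar_ne_zero (w : Val K) : D.rhoScalar w ≠ 0 := by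
  rw [rhoScalar]
  exact inv_ne_zero (Nat.cast_ne_zero.mpr (D.localDegreeMod_ne_zero w))

/-- **IUTchI:Ex3.5(i)** (kurims p. 84): `0 < [K_v̲:(F_mod)_v]⁻¹`. [claim: Mochizuki2012, status: disputed] -/
theorem rhoScalar_pos (w : Val K) : 0 < D.rhoScalar w :=
  pos_iff_ne_zero.mpr (D.rhoScalar_ne_zero w)

/-- **IUTchI:Ex3.5(iii)** (kurims p. 86): the scalar of `ρ^D_v` is nonzero (it is the scalar of `ρ_v`).
[claim: Mochizuki2012, status: disputed] -/
theorem rhoDScalar_ne_zero (w : Val K) : D.rhoDScalar w ≠ 0 :=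
  D.rhoScalar_ne_zero w

/-- **IUTchI:Ex3.5(i)** (kurims p. 84): `ρ_v` in coordinates, `ρ_v(x) = [K_v̲:(F_mod)_v]⁻¹ · x`.
[claim: Mochizuki2012, status: disputed] -/
theorem rho_apply (w : Val K) (x : ℝ≥0) : D.rho w x = D.rhoScalar w * x := rfl

/-- **IUTchI:Ex3.5(i)** (kurims p. 84): `ρ_v` is INJECTIVE ("`ρ_v : Φ_{C^⊩_mod,v} ⥲ Φ^rlf_{C^⊢_v̲}`").
[claim: Mochizuki2012, status: disputed] -/
theorem rho_injective (w : Val K) : Function.Injective (D.rho w) := by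
  intro x y h
  rw [rho_apply, rho_apply] at h
  exact mul_left_cancel₀ (D.rhoScalar_ne_zero w) h

/-- **IUTchI:Ex3.5(i)** (kurims p. 84): `ρ_v` is SURJECTIVE onto `Φ^rlf_{C^⊢_v̲} ≅ ℝ≥0` (`y = ρ_v([K_v̲:(F_mod)_v]·y)`).
[claim: Mochizuki2012, status: disputed] -/
theorem rho_surjective (w : Val K) : Function.Surjective (D.rho w) := by
  intro y
  refine ⟨(D.rhoScalar w)⁻¹ * y, ?_⟩
  rw [rho_apply, ← mul_assoc, mul_inv_cancel₀ (D.rhoScalar_ne_zero w), one_mul]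

/-- **IUTchI:Ex3.5(i)** (kurims p. 84): `ρ_v` is an ISOMORPHISM of monoids (bijective) — the "⥲" of the text at
the level typed. [claim: Mochizuki2012, status: disputed] -/
theorem rho_bijective (w : Val K) : Function.Bijective (D.rho w) :=
  ⟨D.rho_injective w, D.rho_surjective w⟩

/-! ### Rigidity of `(Φ_{C^⊩_mod}, Prime ⥲ V_mod, {ρ_v})` -/

/-- **IUTchII:Cor4.5(ii)** (kurims p. 132) / **IUTchII:Cor4.10(v)** (kurims p. 160) / **IUTchIII:Thm1.5(v)**
(kurims p. 50) "induces AN isomorphism of collections of data", at the REAL divisor-monoid data of [IUTchI] Ex. 3.5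
(i)/(iii): a prime component map `e_v : ℝ≥0 →+ ℝ≥0` compatible with a comparison isomorphism `ρ_w`
(`ρ_w ∘ e_v = ρ_w`, the `D^⊢_v̲`-side target being rigidified by its canonical Frobenius element) is the identity.
[claim: Mochizuki2012, status: disputed] -/
theorem addMonoidHom_eq_id_of_rho_compat (w : Val K) (f : ℝ≥0 →+ ℝ≥0)
    (h : ∀ x, D.rho w (f x) = D.rho w x) : f = AddMonoidHom.id ℝ≥0 :=
  AddMonoidHom.ext fun x => D.rho_injective w (h x)

/-- **IUTchII:Cor4.5(ii)** / **IUTchII:Cor4.10(v)** / **IUTchIII:Thm1.5(v)** at the REAL data of [IUTchI]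
Ex. 3.5: an additive ENDOMORPHISM `e` of `Φ_{C^⊩_mod}` that (a) respects `Prime(C^⊩_mod) ⥲ V_mod` (acts prime-by-prime
through maps `e_v`) and (b) is `ρ`-compatible at every prime (for some `w ∈ V(K)` over `v`, `ρ_w ∘ e_v = ρ_w`) is
the identity. [claim: Mochizuki2012, status: disputed] -/
theorem phiMod_addMonoidHom_eq_id_of_rho_compat (e : D.PhiMod →+ D.PhiMod)
    (ev : Val (fieldOfModuli E) → (ℝ≥0 →+ ℝ≥0))
    (he : ∀ v x, e (Finsupp.single v x) = Finsupp.single v (ev v x))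
    (hρ : ∀ v, ∃ w : Val K, ∀ x, D.rho w (ev v x) = D.rho w x) : e = AddMonoidHom.id _ := by
  refine Finsupp.addHom_ext fun v x => ?_
  obtain ⟨w, hw⟩ := hρ v
  rw [he v x, D.addMonoidHom_eq_id_of_rho_compat w (ev v) hw]
  rfl

/-- **IUTchII:Cor4.5(ii)** / **IUTchII:Cor4.10(v)** / **IUTchIII:Thm1.5(v)** at the REAL data of [IUTchI]
Ex. 3.5 (AUTOMORPHISM form): an automorphism of `(Φ_{C^⊩_mod}, Prime(C^⊩_mod) ⥲ V_mod, {ρ_v})` — additive, prime-by-prime,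
`ρ`-compatible — is the identity; i.e. parallel isomorphisms of the upstream data induce THE SAME (identity)
automorphism: "AN isomorphism". [claim: Mochizuki2012, status: disputed] -/
theorem phiMod_addEquiv_eq_refl_of_rho_compat (e : D.PhiMod ≃+ D.PhiMod)
    (ev : Val (fieldOfModuli E) → (ℝ≥0 →+ ℝ≥0))
    (he : ∀ v x, e (Finsupp.single v x) = Finsupp.single v (ev v x))
    (hρ : ∀ v, ∃ w : Val K, ∀ x, D.rho w (ev v x) = D.rho w x) : e = AddEquiv.refl _ := by
  have h := D.phiMod_addMonoidHom_eq_id_of_rho_compat e.toAddMonoidHom ev he hρ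
  exact AddEquiv.ext fun x => DFunLike.congr_fun h x

/-- **IUTchII:Cor4.5(ii)** / **IUTchIII:Thm1.5(v)** at the REAL data of [IUTchI] Ex. 3.5, variant (b′): an
additive endomorphism of `Φ_{C^⊩_mod}` acting prime-by-prime and FIXING THE DISTINGUISHED ELEMENTS `log^⊢_mod(p_v)`
(`logMod v`, the coordinate vector at `v`) is the identity — by the rank-one rigidity of `ℝ≥0` (abc-iut-L6-t2's
`NNRealAddHom.eq_of_apply_eq`: an additive self-map of `ℝ≥0` is determined by one nonzero value; [IUTchII]
Prop. 4.2 (ii) p. 124 "a unique isomorphism … that maps the distinguished element to the distinguished element").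
[claim: Mochizuki2012, status: disputed] -/
theorem phiMod_addMonoidHom_eq_id_of_fixes_logMod (e : D.PhiMod →+ D.PhiMod)
    (ev : Val (fieldOfModuli E) → (ℝ≥0 →+ ℝ≥0))
    (he : ∀ v x, e (Finsupp.single v x) = Finsupp.single v (ev v x))
    (hfix : ∀ v, e (D.logMod v) = D.logMod v) : e = AddMonoidHom.id _ := by
  refine Finsupp.addHom_ext fun v x => ?_
  have h1 : ev v 1 = 1 := by
    have h := hfix v
    rw [logMod, he v 1] at h
    simpa using (Finsupp.single_injective v) h
  have hev : ev v = AddMonoidHom.id ℝ≥0 :=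
    Literature.IUT.HodgeArakelov.NNRealAddHom.eq_of_apply_eq (ev v) (AddMonoidHom.id ℝ≥0) one_ne_zero h1
  rw [he v x, hev]
  rfl

/-- **IUTchII:Cor4.5(ii)** / **IUTchIII:Thm1.5(v)** at the REAL data of [IUTchI] Ex. 3.5, variant (b′),
AUTOMORPHISM form: a prime-by-prime automorphism of `Φ_{C^⊩_mod}` fixing every `log^⊢_mod(p_v)` is the identity.
[claim: Mochizuki2012, status: disputed] -/
theorem phiMod_addEquiv_eq_refl_of_fixes_logMod (e : D.PhiMod ≃+ D.PhiMod)
    (ev : Val (fieldOfModuli E) → (ℝ≥0 →+ ℝ≥0))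
    (he : ∀ v x, e (Finsupp.single v x) = Finsupp.single v (ev v x))
    (hfix : ∀ v, e (D.logMod v) = D.logMod v) : e = AddEquiv.refl _ := by
  have h := D.phiMod_addMonoidHom_eq_id_of_fixes_logMod e.toAddMonoidHom ev he hfix
  exact AddEquiv.ext fun x => DFunLike.congr_fun h x

/-- **IUTchI:Ex3.5(i)** (kurims p. 84): the image of the distinguished element under `ρ_v` —
`ρ_v(log^⊢_mod(p_v)) = [K_v̲:(F_mod)_v]⁻¹ · log_Φ(p_v)` — in coordinates: `ρ_w 1 = [K_v̲:(F_mod)_v]⁻¹`, a NONZERO element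
of `Φ^rlf_{C^⊢_v̲} ≅ ℝ≥0` (so the prime component is pinned by one nonzero value, cf. `NNRealAddHom.eq_of_apply_eq`).
[claim: Mochizuki2012, status: disputed] -/
theorem rho_one (w : Val K) : D.rho w 1 = D.rhoScalar w := by
  rw [rho_apply, mul_one]

end InitialThetaData

end Ex35

end Literature.IUT.HodgeTheaters
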